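import Mathlib
import Literature.NumberTheory.LFunctions.Zhang2022.DetectorEndgameValidity
import Literature.Analysis.Complex.TuranSecondMainTheorem
import Literature.Analysis.Complex.OneSidedPowerSum
import HarnessLib

/-!
# Zhang (2022), programme F-S3 (cell landau-siegel, family B-det): Turán's second main theorem AS A
# CONFIGURATION-VALID ENDGAME (kernel display for the desk row det-W5-turan of `B-det/DESIGN-MAP-det.md`)

Y. Zhang, *Discrete mean estimates and the Landau–Siegel zero*, arXiv:2211.02515v1
[Zhang2022LandauSiegel] — an unrefereed manuscript under adjudication. **WHAT THIS IS NOT: not a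
claim about Theorems 1–2 of arXiv:2211.02515, about Landau–Siegel zeros, or about Parity.** «The
programme SEARCHES and TYPES; no claim about Landau–Siegel zeros, Theorems 1–2 of arXiv:2211.02515
or a repaired Margin232 until a kernel theorem says so.»

The referee of record for B-det (ls-B-ref-1, REF-B1.md P-det-1) keeps the desk row «W5 Turán» with
the bracket «linear-statistics kernel display pending». This file is that display: Turán's second
main theorem (`Literature.Analysis.Complex.PowerSum.exists_powerSum_ge_max`, PROVED in the tree)
phrased as an instance of `Det.ConfigValidOn` (`DetectorEndgameValidity.lean` v3): for fixed
`n` (number of sampled points), `D` (start of the exponent range) and `R > 0` (the largest modulus),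
the objective
  `Φ(ℓ) = max_{ν' < n} ( |ℓ_{ν'}| − c(n,D)·R^{D+1+ν'}·Re ℓ_last )`,
on the `n + 1` LINEAR statistics `ℓ_{ν'} = Σ_ρ w(ρ) z_ρ^{D+1+ν'}` and `ℓ_last = Σ_ρ w(ρ)·𝟙[ρ = ρ₀] = w(ρ₀)`
of ONE non-negatively weighted configuration, is `≥ 0` on the constraint «`n` points, `z_{ρ₀}` of
maximal modulus `R ≠ 0`» — `Det.configValidOn_turanII`. Hence, by `Det.ConfigValidOn.mainOrder_nonneg`,
a TURÁN-II endgame on fence expectations never closes at main order (the row's word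
«no (decided) [given det-E5 = E-081]»). v2 adds the same display for Turán's FIRST main theorem
(`PowerSum.exists_powerSum_ge`, complex coefficients): `Det.configValidOn_turanI`; v3 the ONE-SIDED
power-sum inequality (`PowerSum.exists_re_powerSum_ge`, LMO 1979 / Thorner–Zaman 2017):
`Det.configValidOn_oneSided`; v4 the LARGE-VALUES COUNT in Chebyshev form: `Det.configValidOn_chebyshev`.
Elementary repackaging; 0 named facts, 0 sorries.

## References

* P. Turán, *Eine neue Methode in der Analysis und deren Anwendungen* (1953), second main theorem —
  as proved in the tree (`TuranSecondMainTheorem.lean`). [cite: Zhang2022LandauSiegel, §2 (2.16)]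
-/

noncomputable section

open Complex Real Finset

namespace Literature.NumberTheory.LFunctions.Zhang2022.Det

open Literature.Analysis.Complex.PowerSum

/-- Turán's constant `c(n,D) = e^{−n}·(n/(250(D+n)))^{n+1}` (as in `exists_powerSum_ge_max`).
[cite: Zhang2022LandauSiegel, §2 (2.16)] -/
def turanConst (n D : ℕ) : ℝ := Real.exp (-(n : ℝ)) * ((n : ℝ) / (250 * (D + n))) ^ (n + 1)

/-- **The TURÁN-II endgame objective** on `n + 1` linear statistics (`n` power sums over the range
`ν ∈ [D+1, D+n]` and, last, the isolated weight `w(ρ₀)`): `max_{ν'} (|ℓ_{ν'}| − c(n,D)·R^{D+1+ν'}·Re ℓ_last)`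
(for `n = 0` the objective is `0`). The design «closes» iff `Φ < 0`, i.e. iff EVERY power sum in the
range is below Turán's lower bound. [cite: Zhang2022LandauSiegel, §2 (2.16)] -/
def turanObjective (n D : ℕ) (R : ℝ) (ℓ : LinData (n + 1)) (_G : GramData 0) : ℝ :=
  if h : 0 < n then
    (Finset.univ : Finset (Fin n)).sup' (Finset.univ_nonempty_iff.mpr ⟨⟨0, h⟩⟩)
      (fun ν' => ‖ℓ (Fin.castSucc ν')‖ - turanConst n D * R ^ (D + 1 + (ν' : ℕ)) * (ℓ (Fin.last n)).re)
  else 0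

/-- **The TURÁN-II constraint** on a configuration `(Z, w, f, u)`: `Z` has `n` points; there are nodes
`z` with a point `ρ₀ ∈ Z` of maximal modulus `R ≠ 0`; the first `n` test families are the powers
`f_{ν'}(ρ) = z_ρ^{D+1+ν'}` and the last is the indicator of `ρ₀` (`= 1` at `ρ₀`, `= 0` elsewhere). (No condition on the weights: the
constraint is scale-invariant.) [cite: Zhang2022LandauSiegel, §2 (2.16)] -/
def TuranConstraint (n D : ℕ) (R : ℝ) {ι : Type} (Z : Finset ι) (_w : ι → ℝ)
    (f : Fin (n + 1) → ι → ℂ) (_u : Fin 0 → ι → ℂ) : Prop :=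
  Z.card = n ∧ ∃ (z : ι → ℂ) (ρ₀ : ι), ρ₀ ∈ Z ∧ (∀ ρ ∈ Z, ‖z ρ‖ ≤ ‖z ρ₀‖) ∧ ‖z ρ₀‖ = R ∧ z ρ₀ ≠ 0 ∧
    (∀ ν' : Fin n, ∀ ρ, f (Fin.castSucc ν') ρ = z ρ ^ (D + 1 + (ν' : ℕ))) ∧
    f (Fin.last n) ρ₀ = 1 ∧ (∀ ρ, ρ ≠ ρ₀ → f (Fin.last n) ρ = 0)

/-- The Turán constraint ignores the weights (scale invariance needed by `mainOrder_nonneg`).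
[cite: Zhang2022LandauSiegel, §2 (2.16)] -/
theorem turanConstraint_scale (n D : ℕ) (R : ℝ) {ι : Type} (Z : Finset ι) (w : ι → ℝ)
    (f : Fin (n + 1) → ι → ℂ) (u : Fin 0 → ι → ℂ) (X : ℝ) (_hX : 0 < X)
    (h : TuranConstraint n D R Z w f u) : TuranConstraint n D R Z (fun ρ => w ρ / X) f u := h

/-- **Turán's second main theorem is a configuration-valid endgame**: on every finite non-negatively
weighted configuration satisfying the Turán constraint, the TURÁN-II objective is `≥ 0` — i.e. some
power sum in the range `[D+1, D+n]` is at least `c(n,D)·w(ρ₀)·R^ν`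
(`PowerSum.exists_powerSum_ge_max`). [cite: Zhang2022LandauSiegel, §2 (2.16)] -/
theorem configValidOn_turanII (n D : ℕ) (R : ℝ) :
    ConfigValidOn (q := n + 1) (r := 0) (TuranConstraint n D R) (turanObjective n D R) := by
  intro ι Z w hw f u hC
  obtain ⟨hcard, z, ρ₀, hρ₀, hmax, hR, hz₀, hf, hlast1, hlast0⟩ := hC
  unfold turanObjective
  by_cases hn : 0 < n
  · rw [dif_pos hn]
    obtain ⟨ν, hν, hineq⟩ := exists_powerSum_ge_max Z z w hw hρ₀ hmax hz₀ D
    rw [hcard] at hν hineq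
    rw [hR, Finset.mem_Icc] at *
    have hν' : ν - (D + 1) < n := by omega
    refine le_trans ?_ (Finset.le_sup' _ (Finset.mem_univ (⟨ν - (D + 1), hν'⟩ : Fin n)))
    have hpow : configLin Z w f (Fin.castSucc ⟨ν - (D + 1), hν'⟩) = ∑ j ∈ Z, (w j : ℂ) * z j ^ ν := by
      unfold configLin
      refine Finset.sum_congr rfl fun ρ _ => ?_
      rw [hf]
      congr 2
      dsimp only
      omega
    have hlast' : configLin Z w f (Fin.last n) = (w ρ₀ : ℂ) := by
      unfold configLin
      rw [Finset.sum_eq_single_of_mem ρ₀ hρ₀ (fun ρ _ hne => by rw [hlast0 ρ hne, mul_zero]),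
        hlast1, mul_one]
    have hexp : D + 1 + (ν - (D + 1)) = ν := by omega
    dsimp only
    rw [hpow, hlast', Complex.ofReal_re, hexp]
    have hc : w ρ₀ * turanConst n D * R ^ ν ≤ ‖∑ j ∈ Z, (w j : ℂ) * z j ^ ν‖ := by
      unfold turanConst
      simpa [mul_assoc] using hineq
    rw [show turanConst n D * R ^ ν * w ρ₀ = w ρ₀ * turanConst n D * R ^ ν by ring]
    linarith
  · rw [dif_neg hn]

/-! ## v2 · Turán's FIRST main theorem (complex weights) as a configuration-valid endgame -/

/-- Turán's first-main-theorem constant `C(n,m) = 2^n · binom(m+n+1, n+1)` (as in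
`exists_powerSum_ge`). [cite: Zhang2022LandauSiegel, §2 (2.16)] -/
def turanIConst (n m : ℕ) : ℝ := (2 : ℝ) ^ n * ((m + n + 1).choose (n + 1) : ℝ)

/-- **The TURÁN-I endgame objective** on `n + 1` linear statistics (`n` weighted power sums
`Σ_ρ w(ρ)c_ρ z_ρ^ν`, `ν ∈ [m+1, m+n]`, with COMPLEX coefficients `b_ρ = w(ρ)c_ρ`, and, last, the
coefficient sum `Σ_ρ w(ρ)c_ρ = Σ b_ρ`): `max_{ν'} (C(n,m)·|ℓ_{ν'}| − ρ₀^{m+1+ν'}·|ℓ_last|)` (`0` for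
`n = 0`). [cite: Zhang2022LandauSiegel, §2 (2.16)] -/
def turanIObjective (n m : ℕ) (ρ₀ : ℝ) (ℓ : LinData (n + 1)) (_G : GramData 0) : ℝ :=
  if h : 0 < n then
    (Finset.univ : Finset (Fin n)).sup' (Finset.univ_nonempty_iff.mpr ⟨⟨0, h⟩⟩)
      (fun ν' => turanIConst n m * ‖ℓ (Fin.castSucc ν')‖ - ρ₀ ^ (m + 1 + (ν' : ℕ)) * ‖ℓ (Fin.last n)‖)
  else 0

/-- **The TURÁN-I constraint**: `n` points, nodes `z` of modulus `≥ ρ₀` on the configuration, complex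
coefficients `c`, test families `f_{ν'}(ρ) = c_ρ z_ρ^{m+1+ν'}` and `f_last(ρ) = c_ρ` (weight-free,
hence scale-invariant). [cite: Zhang2022LandauSiegel, §2 (2.16)] -/
def TuranIConstraint (n m : ℕ) (ρ₀ : ℝ) {ι : Type} (Z : Finset ι) (_w : ι → ℝ)
    (f : Fin (n + 1) → ι → ℂ) (_u : Fin 0 → ι → ℂ) : Prop :=
  Z.card = n ∧ ∃ (z c : ι → ℂ), (∀ ρ ∈ Z, ρ₀ ≤ ‖z ρ‖) ∧
    (∀ ν' : Fin n, ∀ ρ, f (Fin.castSucc ν') ρ = c ρ * z ρ ^ (m + 1 + (ν' : ℕ))) ∧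
    (∀ ρ, f (Fin.last n) ρ = c ρ)

/-- The Turán-I constraint ignores the weights. [cite: Zhang2022LandauSiegel, §2 (2.16)] -/
theorem turanIConstraint_scale (n m : ℕ) (ρ₀ : ℝ) {ι : Type} (Z : Finset ι) (w : ι → ℝ)
    (f : Fin (n + 1) → ι → ℂ) (u : Fin 0 → ι → ℂ) (X : ℝ) (_hX : 0 < X)
    (h : TuranIConstraint n m ρ₀ Z w f u) : TuranIConstraint n m ρ₀ Z (fun ρ => w ρ / X) f u := h

/-- **Turán's first main theorem is a configuration-valid endgame** (for `ρ₀ > 0`): on every finite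
non-negatively weighted configuration satisfying the Turán-I constraint the TURÁN-I objective is
`≥ 0` — some power sum in `[m+1, m+n]` satisfies `ρ₀^ν|Σ b_ρ| ≤ C(n,m)|Σ b_ρ z_ρ^ν|`
(`PowerSum.exists_powerSum_ge`, complex coefficients `b_ρ = w(ρ)c_ρ`).
[cite: Zhang2022LandauSiegel, §2 (2.16)] -/
theorem configValidOn_turanI (n m : ℕ) {ρ₀ : ℝ} (hρ : 0 < ρ₀) :
    ConfigValidOn (q := n + 1) (r := 0) (TuranIConstraint n m ρ₀) (turanIObjective n m ρ₀) := by
  intro ι Z w _hw f u hC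
  obtain ⟨hcard, z, c, hz, hf, hlast⟩ := hC
  unfold turanIObjective
  by_cases hn : 0 < n
  · rw [dif_pos hn]
    have hne : Z.Nonempty := by
      rw [← Finset.card_pos, hcard]; exact hn
    obtain ⟨ν, hν, hineq⟩ :=
      exists_powerSum_ge Z hne z (fun j => (w j : ℂ) * c j) hρ hz m
    rw [hcard, Finset.mem_Icc] at hν
    rw [hcard] at hineq
    have hν' : ν - (m + 1) < n := by omega
    refine le_trans ?_ (Finset.le_sup' _ (Finset.mem_univ (⟨ν - (m + 1), hν'⟩ : Fin n)))
    have hpow : configLin Z w f (Fin.castSucc ⟨ν - (m + 1), hν'⟩) =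
        ∑ j ∈ Z, (w j : ℂ) * c j * z j ^ ν := by
      unfold configLin
      refine Finset.sum_congr rfl fun ρ _ => ?_
      rw [hf, ← mul_assoc]
      congr 2
      dsimp only
      omega
    have hlast' : configLin Z w f (Fin.last n) = ∑ j ∈ Z, (w j : ℂ) * c j := by
      unfold configLin
      exact Finset.sum_congr rfl fun ρ _ => by rw [hlast]
    have hexp : m + 1 + (ν - (m + 1)) = ν := by omega
    dsimp only
    rw [hpow, hlast', hexp]
    have hc : ρ₀ ^ ν * ‖∑ j ∈ Z, (w j : ℂ) * c j‖ ≤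
        turanIConst n m * ‖∑ j ∈ Z, (w j : ℂ) * c j * z j ^ ν‖ := by
      unfold turanIConst
      simpa using hineq
    linarith
  · rw [dif_neg hn]

/-! ## v3 · The ONE-SIDED power-sum inequality (LMO 1979 / Thorner–Zaman 2017) as a configuration-valid endgame -/

/-- The one-sided power-sum constant `ε/(48+5ε)` (as in `exists_re_powerSum_ge`).
[cite: Zhang2022LandauSiegel, §2 (2.16)] -/
def oneSidedConst (ε : ℝ) : ℝ := ε / (48 + 5 * ε)

/-- **The ONE-SIDED endgame objective** on `M + 1` linear statistics (the weighted power sums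
`Σ_ρ w(ρ) z_ρ^m`, `m = 1..M`, REAL PARTS only, and — last — the weight `w(ρ₀)` of an extremal node):
`max_{m ≤ M} (Re ℓ_m − (ε/(48+5ε))·R^m·Re ℓ_last)` (`0` for `M = 0`). [cite: Zhang2022LandauSiegel, §2 (2.16)] -/
def oneSidedObjective (M : ℕ) (ε R : ℝ) (ℓ : LinData (M + 1)) (_G : GramData 0) : ℝ :=
  if h : 0 < M then
    (Finset.univ : Finset (Fin M)).sup' (Finset.univ_nonempty_iff.mpr ⟨⟨0, h⟩⟩)
      (fun ν' => (ℓ (Fin.castSucc ν')).re - oneSidedConst ε * R ^ ((ν' : ℕ) + 1) * (ℓ (Fin.last M)).re)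
  else 0

/-- **The ONE-SIDED constraint**: nodes `z` with an extremal node `ρ₀ ∈ Z` of modulus `R`, `z_{ρ₀} ≠ 0`,
POSITIVE weight at `ρ₀`, the LMO range condition `(12+ε)·Σ_ρ w(ρ)|z_ρ| / (w(ρ₀)|z_{ρ₀}|) ≤ M`
(scale-invariant in the weights), test families `f_{ν'}(ρ) = z_ρ^{ν'+1}` and `f_last = 𝟙_{ρ₀}`.
[cite: Zhang2022LandauSiegel, §2 (2.16)] -/
def OneSidedConstraint (M : ℕ) (ε R : ℝ) {ι : Type} (Z : Finset ι) (w : ι → ℝ)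
    (f : Fin (M + 1) → ι → ℂ) (_u : Fin 0 → ι → ℂ) : Prop :=
  ∃ (z : ι → ℂ) (ρ₀ : ι), ρ₀ ∈ Z ∧ 0 < w ρ₀ ∧ (∀ ρ ∈ Z, ‖z ρ‖ ≤ ‖z ρ₀‖) ∧ ‖z ρ₀‖ = R ∧ z ρ₀ ≠ 0 ∧
    (12 + ε) * ((∑ ρ ∈ Z, w ρ * ‖z ρ‖) / (w ρ₀ * ‖z ρ₀‖)) ≤ M ∧
    (∀ ν' : Fin M, ∀ ρ, f (Fin.castSucc ν') ρ = z ρ ^ ((ν' : ℕ) + 1)) ∧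
    f (Fin.last M) ρ₀ = 1 ∧ (∀ ρ, ρ ≠ ρ₀ → f (Fin.last M) ρ = 0)

/-- The one-sided constraint is invariant under rescaling the weights by `X > 0` (the range condition
is a RATIO of weights). [cite: Zhang2022LandauSiegel, §2 (2.16)] -/
theorem oneSidedConstraint_scale (M : ℕ) (ε R : ℝ) {ι : Type} (Z : Finset ι) (w : ι → ℝ)
    (f : Fin (M + 1) → ι → ℂ) (u : Fin 0 → ι → ℂ) (X : ℝ) (hX : 0 < X)
    (h : OneSidedConstraint M ε R Z w f u) : OneSidedConstraint M ε R Z (fun ρ => w ρ / X) f u := by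
  obtain ⟨z, ρ₀, hρ₀, hw₀, hmax, hR, hz₀, hrange, hf, h1, h0⟩ := h
  refine ⟨z, ρ₀, hρ₀, div_pos hw₀ hX, hmax, hR, hz₀, ?_, hf, h1, h0⟩
  have hrw : (∑ ρ ∈ Z, w ρ / X * ‖z ρ‖) / (w ρ₀ / X * ‖z ρ₀‖) =
      (∑ ρ ∈ Z, w ρ * ‖z ρ‖) / (w ρ₀ * ‖z ρ₀‖) := by
    have hsum : ∑ ρ ∈ Z, w ρ / X * ‖z ρ‖ = (∑ ρ ∈ Z, w ρ * ‖z ρ‖) / X := by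
      rw [Finset.sum_div]
      exact Finset.sum_congr rfl fun ρ _ => by ring
    rw [hsum]
    field_simp
  rw [hrw]
  exact hrange

/-- **The one-sided power-sum inequality is a configuration-valid endgame** (for `ε > 0`): on every
finite non-negatively weighted configuration satisfying the one-sided constraint the ONE-SIDED
objective is `≥ 0` — some `m ≤ M` has `Re Σ_ρ w(ρ)z_ρ^m ≥ (ε/(48+5ε))·w(ρ₀)·R^m`
(`PowerSum.exists_re_powerSum_ge`: Lagarias–Montgomery–Odlyzko 1979 Thm. 4.2 / Thorner–Zaman 2017,
in tree). [cite: Zhang2022LandauSiegel, §2 (2.16)] -/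
theorem configValidOn_oneSided (M : ℕ) {ε : ℝ} (hε : 0 < ε) (R : ℝ) :
    ConfigValidOn (q := M + 1) (r := 0) (OneSidedConstraint M ε R) (oneSidedObjective M ε R) := by
  intro ι Z w hw f u hC
  obtain ⟨z, ρ₀, hρ₀, hw₀, hmax, hR, hz₀, hrange, hf, h1, h0⟩ := hC
  obtain ⟨m, hm1, hmM, hineq⟩ := exists_re_powerSum_ge Z z w hw hρ₀ hw₀ hmax hz₀ hε
  have hmM' : m ≤ M := by
    have : (m : ℝ) ≤ (M : ℝ) := hmM.trans hrange
    exact_mod_cast this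
  have hMpos : 0 < M := lt_of_lt_of_le hm1 hmM'
  unfold oneSidedObjective
  rw [dif_pos hMpos]
  have hν' : m - 1 < M := by omega
  refine le_trans ?_ (Finset.le_sup' _ (Finset.mem_univ (⟨m - 1, hν'⟩ : Fin M)))
  have hpow : configLin Z w f (Fin.castSucc ⟨m - 1, hν'⟩) = ∑ j ∈ Z, (w j : ℂ) * z j ^ m := by
    unfold configLin
    refine Finset.sum_congr rfl fun ρ _ => ?_
    rw [hf]
    congr 2
    dsimp only
    omega
  have hlast : configLin Z w f (Fin.last M) = (w ρ₀ : ℂ) := by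
    unfold configLin
    rw [Finset.sum_eq_single_of_mem ρ₀ hρ₀ (fun ρ _ hne => by rw [h0 ρ hne, mul_zero]), h1, mul_one]
  have hexp : (m - 1 : ℕ) + 1 = m := by omega
  dsimp only
  rw [hpow, hlast, hexp, Complex.ofReal_re, ← hR]
  unfold oneSidedConst
  linarith

/-! ## v4 · The LARGE-VALUES COUNT (Chebyshev form) as a configuration-valid endgame -/

/-- **The large-values (Chebyshev) objective** on two linear statistics — `ℓ₀ = Σ_ρ w(ρ)|F(ρ)|²`
(second moment of a statistic `F` over the configuration) and `ℓ₁ = Σ_{ρ : |F(ρ)| ≥ V} w(ρ)` (the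
weighted COUNT of large values): `Re ℓ₀ − V²·Re ℓ₁`. [cite: Zhang2022LandauSiegel, §2 (2.16)] -/
def chebyshevObjective (V : ℝ) (ℓ : LinData 2) (_G : GramData 0) : ℝ :=
  (ℓ 0).re - V ^ 2 * (ℓ 1).re

/-- **The large-values constraint**: `f₀(ρ) = |F(ρ)|²` and `f₁ = 𝟙{|F(ρ)| ≥ V}` for some statistic
`F` on the configuration (weight-free, hence scale-invariant). [cite: Zhang2022LandauSiegel, §2 (2.16)] -/
def ChebyshevConstraint (V : ℝ) {ι : Type} (_Z : Finset ι) (_w : ι → ℝ)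
    (f : Fin 2 → ι → ℂ) (_u : Fin 0 → ι → ℂ) : Prop :=
  ∃ F : ι → ℂ, (∀ ρ, f 0 ρ = ((‖F ρ‖ ^ 2 : ℝ) : ℂ)) ∧
    (∀ ρ, (f 1 ρ = 1 ∧ V ≤ ‖F ρ‖) ∨ (f 1 ρ = 0 ∧ ‖F ρ‖ < V))

/-- The large-values constraint ignores the weights. [cite: Zhang2022LandauSiegel, §2 (2.16)] -/
theorem chebyshevConstraint_scale (V : ℝ) {ι : Type} (Z : Finset ι) (w : ι → ℝ)
    (f : Fin 2 → ι → ℂ) (u : Fin 0 → ι → ℂ) (X : ℝ) (_hX : 0 < X)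
    (h : ChebyshevConstraint V Z w f u) : ChebyshevConstraint V Z (fun ρ => w ρ / X) f u := h

/-- **The large-values count is a configuration-valid endgame** (for `V ≥ 0`): on every finite
non-negatively weighted configuration, `V²·#_w{ρ : |F(ρ)| ≥ V} ≤ Σ_ρ w(ρ)|F(ρ)|²` (Chebyshev), i.e.
the objective is `≥ 0` — zero-counting / large-values endgames of this form are valid, hence inert on
configurational main terms. [cite: Zhang2022LandauSiegel, §2 (2.16)] -/
theorem configValidOn_chebyshev {V : ℝ} (hV : 0 ≤ V) :
    ConfigValidOn (q := 2) (r := 0) (ChebyshevConstraint V) (chebyshevObjective V) := by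
  intro ι Z w hw f u hC
  obtain ⟨F, hf0, hf1⟩ := hC
  unfold chebyshevObjective configLin
  rw [Complex.re_sum, Complex.re_sum, Finset.mul_sum, ← Finset.sum_sub_distrib]
  refine Finset.sum_nonneg fun ρ hρ => ?_
  have hwρ := hw ρ hρ
  rw [hf0 ρ, ← Complex.ofReal_mul, Complex.ofReal_re]
  rcases hf1 ρ with ⟨h1, hV'⟩ | ⟨h0, _⟩
  · rw [h1, mul_one, Complex.ofReal_re]
    have hsq : V ^ 2 ≤ ‖F ρ‖ ^ 2 := pow_le_pow_left₀ hV hV' 2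
    nlinarith [mul_le_mul_of_nonneg_left hsq hwρ]
  · rw [h0, mul_zero, Complex.zero_re, mul_zero, sub_zero]
    exact mul_nonneg hwρ (by positivity)

end Literature.NumberTheory.LFunctions.Zhang2022.Det

end
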